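import Mathlib
import HarnessLib
import Summits.Langlands.Langlands.Theses.NonParallelVoid
import Literature.NumberTheory.Automorphic.GLnAdelicStructureProofs

/-!
# Birth skeleton (BC3) for crux stmt-Langlands-17002
`Summit.Langlands.Langlands.Theses.NonParallelVoid.LocallyReducibleParallel` — line `birth`

Route `route-Langlands-NonParallelVoid` (`closes : EmptyWeightCore → TwistedInductionParallel →
TensorSquareParallel → LocallyReducibleParallel → ResidueParallel → VoidToLanglands → Langlands`).
The crux (rank 5, THE NEARLY ORDINARY SECTOR) says: for `F` imaginary quadratic, any prime `p`, and
every irreducible, almost everywhere unramified `ρ : Γ_F → GL₂(ℚ̄_p)` which is de Rham at each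
`v ∣ p` (pinned Fontaine datum `fontainePstAdicCompletion v p hv`) with two DISTINCT `τ`-labelled
Hodge–Tate weights `{a, b}` at every label `(v, τ : F_v →ₐ[ℚ_p] ℚ̄_p)`, and which stabilises a
complete flag at EVERY `v ∣ p` (`FramedRep.HasInvariantCompleteFlag (ρ.toLocal v)`: nearly
ordinary in the sense of Calegari–Mazur, any residual image), all labels have the same gap:
`∃ g, ∀ (v, τ), ∃ a, HT_τ(ρ|_{F_v}) = {a, a + g}`.

This file concludes the crux BY NAME from three named stubs, cut along the seam of the only
mechanism that has ever proved a case of it with arbitrary residual image in view — the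
AUTOMORPHY seam of Allen–Calegari–Caraiani–Gee–Helm–Le Hung–Newton–Scholze–Taylor–Thorne 2023,
Rem. 6.1.3 ("it follows from the existence of `Π` that the weight `λ` is conjugate self-dual up to
twist"): (1) a nearly ordinary `ρ` as in the crux IS AUTOMORPHIC — it is `r_ι(π)` for a cuspidal
REGULAR ALGEBRAIC `π` on `GL₂(𝔸_F)` (Hida theory / ordinary `R = T` / Skinner–Wiles at Eisenstein
primes: the open core, and the only place where the invariant flags are used); (2) the labelled
Hodge–Tate weights of an automorphic `ρ` are read off the infinity type of `π` through `ι` (A'Campo–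
Hevesi–Thorne–Whitmore 2026, Thm. 1.2.1, exact-weights clause; known in print); (3) Clozel's purity
lemma forces the infinity type of a regular algebraic cuspidal `π` over an IMAGINARY QUADRATIC field
to have ONE gap at both complex embeddings (Clozel 1990 Lemme 4.9 = clause (iii) of the tree's named
fact `Clozel1990_regularAlgebraic`; Harder's vanishing of cuspidal cohomology in non-parallel
weight).  The composition is genuine multiset arithmetic (kernel-checked, no `sorry`): the common
affine dictionary `HT_τ = {c − a}` transports the common archimedean gap `g ∈ ℕ` to every `p`-adic
label, and the ordering `a < b` of the crux's weights pins the orientation.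

* `stub_nearlyOrdinaryAutomorphy` — THE OPEN CORE.  `F` imaginary quadratic, `p` any prime, `ρ` as
  in the crux (irreducible, a.e. unramified, de Rham with two distinct labelled weights at every
  label, invariant complete flag at every `v ∣ p`) ⇒ for the (proved) compactness fact `hcpt` there
  are a cuspidal `π` on `GL₂(𝔸_F)` and `ι : ℚ̄_p ≃ ℂ` with `π` REGULAR ALGEBRAIC and, at cofinitely
  many finite `v`, `ρ` unramified with arithmetic-Frobenius characteristic polynomial
  `∏ (X − ι⁻¹((q_v^{1/2} α_j)⁻¹))` for every Satake parameter `α` of `π` at `v` (HLTT's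
  normalisation `r_ι(π) ↔ π ⊗ |det|^{-1/2}`, the tree's `arithFrobPolyOfSatake ι q_v 2 α`, exactly
  the conclusion shape of `exists_galoisRep_of_regularAlgebraic`).  Known: `p > 2` split, `ρ`
  ordinary with `ρ̄` decomposed generic of enormous image and residually ordinarily automorphic
  (ACCGHLNSTT2023 Thm. 6.1.2); CM/dihedral `ρ` (automorphic induction).  OPEN: residually reducible
  `ρ̄` (Skinner–Wiles at defect one over a field with a complex place), residually dihedral/small
  image, `p` inert or ramified, `p = 2`.  It is Fontaine–Mazur–Langlands direction (B) on the nearly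
  ordinary regular rank-2 sector over imaginary quadratic fields, in the C-normalisation and with
  the regularity of `π` asserted — neither implied by nor implying the crux cheaply (the summit's
  `GaloisToAutomorphic` gives an L-algebraic `π` and no archimedean/Hodge–Tate dictionary).
* `stub_hodgeTateOfInfinityType` — THE DICTIONARY (known in print).  `F` imaginary quadratic, `π`
  cuspidal on `GL₂(𝔸_F)` with infinity type `T` (`HasInfinityType`), `T` regular algebraic, `p`,
  `ι`, `ρ : Γ_F → GL₂(ℚ̄_p)` irreducible with the compatibility of stub 1 ⇒ there is ONE `c ∈ ℂ`
  such that at every `v ∣ p` and every label `τ : F_v →ₐ[ℚ_p] ℚ̄_p`,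
  `HT_τ(ρ|_{F_v}) = {c − a : a ∈ a-multiset of T at the complex embedding ι ∘ τ ∘ (F → F_v)}`
  (as multisets of complex numbers).  In print `c = 1/2` (`= (n−1)/2`): AHTW2026 Thm. 1.2.1,
  `HT_τ(r_{π,ι}) = {λ_{ιτ,1} + 1, λ_{ιτ,2}}` for `π` of weight `λ`, i.e. `{1/2 − a}` for the
  Harish-Chandra parameter `{a} = {−λ_{ιτ,2} + 1/2, −λ_{ιτ,1} − 1/2}` of `π_{ιτ}`; `ρ ≅ r_{π,ι}` by
  Chebotarev + Brauer–Nesbitt (`ρ` irreducible, same Frobenius polynomials cofinitely); the tree's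
  conventions `HT(ε) = {−1}` (`labelledHodgeTateWeights`) and "weight `(a, b)` contributes `−a`"
  (`InfinityType.hodgeTateWeights`) fix the orientation `a ↦ c − a`; the shift `c` is left
  existential (uniform in the label) so that no normalisation slip can falsify the stub.  Formally
  XL (contains HLTT Thm. A uniqueness and AHTW's theorem); the tree's `AHTW2026.deRham_hodgeTateRegular`
  vendors only the `Nodup` shadow of this clause.
* `stub_purityParallelGap` — PURITY (provable now from the named fact, size M).  `F` imaginary
  quadratic, `π` cuspidal on `GL₂(𝔸_F)` with a regular algebraic infinity type `T` ⇒ there is ONE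
  `g ∈ ℕ` with `a-multiset of T at σ = {a_σ, a_σ + g}` at EVERY complex embedding `σ`.  Proof on
  paper: `Clozel1990_regularAlgebraic` (iii) gives `w` with `{a at c∘σ} = {w − a at σ}`; the two
  exponents at `σ₀` are distinct half-integers `a₁ < a₂ = a₁ + g`, `g ∈ ℕ`; at `c∘σ₀` they are
  `{w − a₂, w − a₂ + g}`; and `Hom(F, ℂ) = {σ₀, c∘σ₀}` for `F` imaginary quadratic.  This is the
  statement "cuspidal cohomological Bianchi eigenforms have parallel weight" (Harder), false over CM
  fields of degree ≥ 4 — the reason the route lives over imaginary quadratic fields.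

Shape (for `ledger skeleton check` / `#h21_check_skeleton`): each stub is `theorem stub_<name> :
<Prop> := by sorry` (closed statements over existing declarations only); `_Goal.stub_<name> : Prop
:= type_of% @stub_<name>` names that statement; `LocallyReducibleParallel_of
(h₁ : _Goal.stub_nearlyOrdinaryAutomorphy) (h₂ : _Goal.stub_hodgeTateOfInfinityType)
(h₃ : _Goal.stub_purityParallelGap) : LocallyReducibleParallel` concludes the route decl BY NAME; the
last `example` feeds the three stubs to it.  Sorries: exactly 3, one inside each `stub_*`, none
elsewhere.

Disproof used: none exists — `ledger crux ls stmt-Langlands-17002` lists no workfiles (no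
`Disproof.lean`, no `Negative/` lemma, no dead line, no crux ideas) at registration time
(2026-08-17); `ledger negatives --problem Langlands` (3 entries: SplitPrimeInductionDeinduction,
OrdinaryPrimeTransportRankinSelbergPoleCount, K3KugaSatakeDescentSerreTypeAnchor) contains nothing
of the shape of these stubs.  The vendored `Calegari2010_thm_1_4` (ordinary, `SL₂(𝔽_p)`-image,
non-base-change, `p > 7` split) is a different mechanism (tensor induction) covering a sub-locus of
stub 1's conclusion-free form; it is not used here.
-/

set_option linter.dupNamespace false

noncomputable section

namespace Summit.Langlands.Langlands.Cruxes.LocallyReducibleParallel.Birth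

open Summit.Langlands.Langlands.Theses.NonParallelVoid
open Literature.NumberTheory.GaloisRepresentations Literature.NumberTheory.Automorphic
open Filter

/-! ## 1. The three stubs -/

/-- **STUB 1 — nearly ordinary automorphy (the open core).**  For `F` imaginary quadratic, any
prime `p`, and `ρ : Γ_F → GL₂(ℚ̄_p)` irreducible, unramified almost everywhere, de Rham at every
`v ∣ p` with two distinct `τ`-labelled Hodge–Tate weights at every label (pinned Fontaine datum), and
with an invariant complete flag at EVERY `v ∣ p` (nearly ordinary, any residual image): `ρ` is
automorphic — for the compactness fact `hcpt` there are a cuspidal automorphic representation `π`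
of `GL₂(𝔸_F)` and `ι : ℚ̄_p ≃ ℂ` such that `π` is REGULAR ALGEBRAIC and, at all but finitely many
finite places `v`, for every Satake parameter `α` of `π` at `v`, `ρ` is unramified at `v` with
arithmetic-Frobenius characteristic polynomial `∏_j (X − ι⁻¹((q_v^{1/2} α_j)⁻¹))`
(`arithFrobPolyOfSatake ι q_v 2 α`: HLTT's normalisation `r_ι(π) ↔ π ⊗ |det|^{-1/2}`).  Mechanism in
the known cases: Hida theory makes `ρ` a point of the nearly ordinary Hecke algebra (ordinary
`R = T`, ACCGHLNSTT2023 Thm. 6.1.2 / Rem. 6.1.3 for `p` split, `ρ̄` decomposed generic with enormous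
image; Calegari–Mazur 2009 §2 in general), and de Rham regular points of ordinary families are
classical.  OPEN for residually reducible `ρ̄` (needs a Skinner–Wiles engine at defect one),
residually dihedral / small image, `p` inert or ramified, `p = 2`.  Why it might fail as typed: only
together with Fontaine–Mazur (it is direction (B) of the summit on this sector, C-normalised, plus
"regular Hodge–Tate weights ⇒ `π` regular algebraic").
[cite: ACCGHLNSTT2023, Thm. 6.1.2 and Rem. 6.1.3] [cite: CalegariMazur2008, Conj. 1.3 and §2.4]
[cite: SkinnerWiles1999, §4] [cite: HarrisLanTaylorThorneRMS2016, Thm. A] -/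
theorem stub_nearlyOrdinaryAutomorphy : ∀ (F : Type) [Field F] [NumberField F] [Algebra.IsQuadraticExtension ℚ F], NumberField.IsTotallyComplex F → ∀ (p : ℕ) [Fact p.Prime] (ρ : Literature.NumberTheory.GaloisRepresentations.FramedGaloisRep F (PadicAlgCl p) 2), ρ.toGaloisRep.IsIrreducible → (∀ᶠ v : IsDedekindDomain.HeightOneSpectrum (NumberField.RingOfIntegers F) in Filter.cofinite, ρ.IsUnramifiedAt v) → (∀ (v : IsDedekindDomain.HeightOneSpectrum (NumberField.RingOfIntegers F)) (hv : ((p : ℕ) : NumberField.RingOfIntegers F) ∈ v.asIdeal), (Literature.NumberTheory.PAdicHodge.fontainePstAdicCompletion v p hv).IsDeRhamFramed (ρ.toLocal v) ∧ (letI := (Literature.NumberTheory.PAdicHodge.fontainePstAdicCompletion v p hv).algebra; ∀ τ : v.adicCompletion F →ₐ[ℚ_[p]] PadicAlgCl p, ∃ a b : ℤ, a < b ∧ ρ.labelledHodgeTateWeightsAt v (Literature.NumberTheory.PAdicHodge.fontainePstAdicCompletion v p hv).algebra (Literature.NumberTheory.PAdicHodge.fontainePstAdicCompletion v p hv).𝔅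 τ.toRingHom = {a, b})) → (∀ v : IsDedekindDomain.HeightOneSpectrum (NumberField.RingOfIntegers F), ((p : ℕ) : NumberField.RingOfIntegers F) ∈ v.asIdeal → Literature.NumberTheory.GaloisRepresentations.FramedRep.HasInvariantCompleteFlag (ρ.toLocal v)) → ∀ (hcpt : Literature.NumberTheory.Automorphic.isCompact_glFiniteIntegralLevel 2 F), ∃ (π : Literature.NumberTheory.Automorphic.CuspidalAutomorphicRepData 2 F hcpt) (ι : PadicAlgCl p ≃+* ℂ), π.1.IsRegularAlgebraic ∧ ∀ᶠ v : IsDedekindDomain.HeightOneSpectrum (NumberField.RingOfIntegers F) in Filter.cofinite, ∀ α : Multiset ℂ, π.1.HasSatakeParamAt v α → ρ.IsUnramifiedAt v ∧ ρ.HasFrobCharpolyAt v (Literature.NumberTheory.Automorphic.arithFrobPolyOfSatake ι v.residueCard 2 α) := by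
  sorry

/-- **STUB 2 — the Hodge–Tate / infinity-type dictionary for automorphic `ρ` (known in print).**
For `F` imaginary quadratic, a cuspidal `π` on `GL₂(𝔸_F)` with infinity type `T`
(`HasInfinityType`: `T` well formed and its `a`-multisets are the archimedean parameter of `π`), `T`
regular algebraic, a prime `p`, `ι : ℚ̄_p ≃ ℂ`, and `ρ : Γ_F → GL₂(ℚ̄_p)` IRREDUCIBLE with the
compatibility of stub 1 (so `ρ ≅ r_ι(π)` by Chebotarev and Brauer–Nesbitt): there is one complex
number `c` such that for every `v ∣ p` and every label `τ : F_v →ₐ[ℚ_p] ℚ̄_p` the `τ`-labelled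
Hodge–Tate weights of `ρ|_{Γ_{F_v}}` (pinned Fontaine datum, as in the crux), cast to `ℂ`, are
`{c − a : a ∈ a-multiset of T at σ}` for the complex embedding `σ = ι ∘ τ ∘ (F → F_v)`.  In print
`c = 1/2`: A'Campo–Hevesi–Thorne–Whitmore 2026 Thm. 1.2.1 (`HT_τ(r_{π,ι}) = {λ_{ιτ,1} + 1, λ_{ιτ,2}}`
for `π` of weight `λ`, whose Harish-Chandra parameter at `ιτ` is `{1/2 − λ_{ιτ,2}, −1/2 − λ_{ιτ,1}}`),
with the tree's conventions `HT(ε) = {−1}` and "weight `(a, b)` contributes `−a`"; the uniform shift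
`c` is left existential on purpose (robust to the C/L normalisation of `r_ι(π)`).  Why it might fail
as typed: only through the pinned datum's `HT_τ` not computing Fontaine's (a typing risk shared with
the crux itself).
[cite: AHTW2026, Thm. 1.2.1] [cite: HarrisLanTaylorThorneRMS2016, Thm. A]
[cite: BuzzardGeeLMS2014, Rem. 3.1.3 and Conj. 3.2.2] [cite: Patrikis2019, §2.7.1] -/
theorem stub_hodgeTateOfInfinityType : ∀ (F : Type) [Field F] [NumberField F] [Algebra.IsQuadraticExtension ℚ F], NumberField.IsTotallyComplex F → ∀ (hcpt : Literature.NumberTheory.Automorphic.isCompact_glFiniteIntegralLevel 2 F) (π : Literature.NumberTheory.Automorphic.CuspidalAutomorphicRepData 2 F hcpt) (T : Literature.NumberTheory.Automorphic.InfinityType F 2), π.1.HasInfinityType T → T.IsRegularAlgebraic → ∀ (p : ℕ) [Fact p.Prime] (ι : PadicAlgCl p ≃+* ℂ) (ρ : Literature.NumberTheory.GaloisRepresentations.FramedGaloisRep F (PadicAlgCl p) 2), ρ.toGaloisRep.IsIrreducible → (∀ᶠ v : IsDedekindDomain.HeightOneSpectrum (NumberField.RingOfIntegers F) in Filter.cofinite,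 ∀ α : Multiset ℂ, π.1.HasSatakeParamAt v α → ρ.IsUnramifiedAt v ∧ ρ.HasFrobCharpolyAt v (Literature.NumberTheory.Automorphic.arithFrobPolyOfSatake ι v.residueCard 2 α)) → ∃ c : ℂ, ∀ (v : IsDedekindDomain.HeightOneSpectrum (NumberField.RingOfIntegers F)) (hv : ((p : ℕ) : NumberField.RingOfIntegers F) ∈ v.asIdeal), letI := (Literature.NumberTheory.PAdicHodge.fontainePstAdicCompletion v p hv).algebra; ∀ τ : v.adicCompletion F →ₐ[ℚ_[p]] PadicAlgCl p, (ρ.labelledHodgeTateWeightsAt v (Literature.NumberTheory.PAdicHodge.fontainePstAdicCompletion v p hv).algebra (Literature.NumberTheory.PAdicHodge.fontainePstAdicCompletion v p hv).𝔅 τ.toRingHom).map (fun k : ℤ => (k : ℂ)) = ((T (ι.toRingHom.comp (τ.toRingHom.comp (algebraMap F (v.adicCompletion F))))).map Literature.NumberTheory.Automorphic.ArchWeight.a).map (fun a : ℂ => c - a) := by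
  sorry

/-- **STUB 3 — purity forces ONE archimedean gap over an imaginary quadratic field (provable now
from the named fact `Clozel1990_regularAlgebraic`, clause (iii)).**  For `F` imaginary quadratic
and a cuspidal `π` on `GL₂(𝔸_F)` with a regular algebraic infinity type `T`: there is one natural
number `g` such that at EVERY complex embedding `σ : F → ℂ` the `a`-multiset of `T` is
`{a_σ, a_σ + g}`.  Paper proof: Clozel's purity lemma (Lemme 4.9; tree:
`Clozel1990_regularAlgebraic.purity`) gives `w ∈ ℤ` with `{a at c∘σ} = {w − a : a at σ}`; at one
embedding `σ₀` the two exponents are distinct elements of `1/2 + ℤ` (C-algebraic, regular, two of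
them by well-formedness), say `a₁` and `a₁ + g` with `g ∈ ℕ`; then at `c∘σ₀` they are
`{w − a₁ − g, (w − a₁ − g) + g}`; and `F → ℂ` has exactly the two embeddings `σ₀`, `c∘σ₀ ≠ σ₀`
(`F` imaginary quadratic).  This is "cuspidal cohomological automorphic representations of `GL₂`
over an imaginary quadratic field have parallel weight" (Harder; Borel–Wallach), and it is FALSE over
CM fields of degree `≥ 4`.  Why it might fail as typed: it cannot, short of Clozel's lemma failing;
size M over the named fact (embedding count + half-integer bookkeeping).
[cite: Clozel1990, Lemme 4.9] [cite: Harder1987, §3] [cite: BorelWallach2000, II §6.12] -/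
theorem stub_purityParallelGap : ∀ (F : Type) [Field F] [NumberField F] [Algebra.IsQuadraticExtension ℚ F], NumberField.IsTotallyComplex F → ∀ (hcpt : Literature.NumberTheory.Automorphic.isCompact_glFiniteIntegralLevel 2 F) (π : Literature.NumberTheory.Automorphic.CuspidalAutomorphicRepData 2 F hcpt) (T : Literature.NumberTheory.Automorphic.InfinityType F 2), π.1.HasInfinityType T → T.IsRegularAlgebraic → ∃ g : ℕ, ∀ σ : F →+* ℂ, ∃ a : ℂ, (T σ).map Literature.NumberTheory.Automorphic.ArchWeight.a = {a, a + (g : ℂ)} := by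
  sorry

/-! ## 2. The stub statements as named propositions (the composition's hypotheses, by name)

`_Goal` is internal on purpose: audits listing the file's declarations by short name find the `stub_*`
THEOREMS, while `#h21_check_skeleton` accepts the hypotheses of `LocallyReducibleParallel_of` by the
stub names they carry.  Each `_Goal.stub_x` is `type_of% @stub_x` — no text duplicated, no `sorry`
inherited. -/

namespace _Goal

/-- The statement of `stub_nearlyOrdinaryAutomorphy`, as a named `Prop` (literally its type).
[folklore] -/
def stub_nearlyOrdinaryAutomorphy : Prop :=
  type_of% @Summit.Langlands.Langlands.Cruxes.LocallyReducibleParallel.Birth.stub_nearlyOrdinaryAutomorphy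

/-- The statement of `stub_hodgeTateOfInfinityType`, as a named `Prop` (literally its type).
[folklore] -/
def stub_hodgeTateOfInfinityType : Prop :=
  type_of% @Summit.Langlands.Langlands.Cruxes.LocallyReducibleParallel.Birth.stub_hodgeTateOfInfinityType

/-- The statement of `stub_purityParallelGap`, as a named `Prop` (literally its type). [folklore] -/
def stub_purityParallelGap : Prop :=
  type_of% @Summit.Langlands.Langlands.Cruxes.LocallyReducibleParallel.Birth.stub_purityParallelGap

end _Goal

/-! ## 3. The composition (kernel-checked, no `sorry`): automorphy → dictionary → purity → crux by name -/

/-- **`LocallyReducibleParallel` from the three stubs.**  Given `ρ` as in the crux: stub 1 (with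
the proved compactness fact `isCompact_glFiniteIntegralLevel_holds 2 F`) supplies a cuspidal regular
algebraic `π`, `ι` and the Frobenius compatibility; unfold `IsRegularAlgebraic` to get an infinity
type `T`; stub 2 gives the uniform dictionary `HT_τ(ρ|_{F_v}) = {c − a : a at ι∘τ∘(F → F_v)}`;
stub 3 gives the uniform archimedean gap `g ∈ ℕ`.  At a label `(v, τ)` the crux's hypothesis
provides `HT = {x, y}` with `x < y`; comparing with `{c − a₀, c − a₀ − g}` elementwise (membership in
a two-element multiset, injectivity of `ℤ → ℂ`) leaves only `y = x + g` (the other matchings force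
`x = y` or `y = x − g ≤ x`), so `HT = {x, x + g}` with the SAME integer `g` at every label.  The
hypotheses are, by name, the statements of the three stubs; the conclusion is the route decl.
[folklore] -/
theorem LocallyReducibleParallel_of (h₁ : _Goal.stub_nearlyOrdinaryAutomorphy)
    (h₂ : _Goal.stub_hodgeTateOfInfinityType) (h₃ : _Goal.stub_purityParallelGap) :
    LocallyReducibleParallel := by
  unfold _Goal.stub_nearlyOrdinaryAutomorphy at h₁
  unfold _Goal.stub_hodgeTateOfInfinityType at h₂
  unfold _Goal.stub_purityParallelGap at h₃
  intro F _ _ _ hF p _ ρ hirr hunr hHT hflag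
  -- automorphy of the nearly ordinary `ρ`: a cuspidal regular algebraic `π` with `ρ ≅ r_ι(π)` a.e.
  obtain ⟨π, ι, hreg, hcompat⟩ :=
    h₁ F hF p ρ hirr hunr hHT hflag (isCompact_glFiniteIntegralLevel_holds 2 F)
  obtain ⟨T, hT, hTreg⟩ := hreg
  -- the uniform Hodge–Tate / infinity-type dictionary
  obtain ⟨c, hc⟩ := h₂ F hF _ π T hT hTreg p ι ρ hirr hcompat
  -- purity: one archimedean gap `g` at both complex embeddings
  obtain ⟨g, hg⟩ := h₃ F hF _ π T hT hTreg
  refine ⟨(g : ℤ), ?_⟩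
  intro v hv
  -- the label `τ` lives over the datum's `ℚ_p`-algebra structure on `F_v`
  letI := (Literature.NumberTheory.PAdicHodge.fontainePstAdicCompletion v p hv).algebra
  intro τ
  obtain ⟨x, y, hxy, hHTeq⟩ := (hHT v hv).2 τ
  have hcτ := hc v hv τ
  obtain ⟨a₀, ha₀⟩ := hg (ι.toRingHom.comp (τ.toRingHom.comp (algebraMap F (v.adicCompletion F))))
  rw [hHTeq, ha₀] at hcτ
  simp only [Multiset.insert_eq_cons, Multiset.map_cons, Multiset.map_singleton] at hcτ
  -- `hcτ : ↑x ::ₘ {↑y} = (c - a₀) ::ₘ {c - (a₀ + ↑g)}`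
  have hx : (x : ℂ) = c - a₀ ∨ (x : ℂ) = c - (a₀ + (g : ℂ)) := by
    have hmem : (x : ℂ) ∈ ((c - a₀) ::ₘ ({c - (a₀ + (g : ℂ))} : Multiset ℂ)) := by
      rw [← hcτ]; exact Multiset.mem_cons_self _ _
    simpa only [Multiset.mem_cons, Multiset.mem_singleton] using hmem
  have hy : (y : ℂ) = c - a₀ ∨ (y : ℂ) = c - (a₀ + (g : ℂ)) := by
    have hmem : (y : ℂ) ∈ ((c - a₀) ::ₘ ({c - (a₀ + (g : ℂ))} : Multiset ℂ)) := by
      rw [← hcτ]; exact Multiset.mem_cons_of_mem (Multiset.mem_singleton_self _)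
    simpa only [Multiset.mem_cons, Multiset.mem_singleton] using hmem
  have key : y = x + (g : ℤ) := by
    rcases hx with hx | hx <;> rcases hy with hy | hy
    · exfalso
      have h : (x : ℂ) = (y : ℂ) := hx.trans hy.symm
      exact hxy.ne (by exact_mod_cast h)
    · exfalso
      have h : (y : ℂ) = (x : ℂ) - (g : ℂ) := by rw [hy, hx]; ring
      have h' : y = x - (g : ℤ) := by exact_mod_cast h
      omega
    · have h : (y : ℂ) = (x : ℂ) + (g : ℂ) := by rw [hy, hx]; ring
      exact_mod_cast h
    · exfalso
      have h : (x : ℂ) = (y : ℂ) := hx.trans hy.symm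
      exact hxy.ne (by exact_mod_cast h)
  refine ⟨x, ?_⟩
  rw [hHTeq, key]

/-- By-name sanity check (an `example`, not a declaration of the file): the three stubs feed the
composition as they stand. -/
example : LocallyReducibleParallel :=
  LocallyReducibleParallel_of stub_nearlyOrdinaryAutomorphy stub_hodgeTateOfInfinityType
    stub_purityParallelGap

end Summit.Langlands.Langlands.Cruxes.LocallyReducibleParallel.Birth

end
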